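import Literature.MathematicalPhysics.QuantumFieldTheory.Balaban1983to89.B6Ineq2147TwoScaleV1

/-!
# `Balaban1983to89.B6Ineq2147TwoScaleV1B1` — T. Bałaban, *Propagators and renormalization transformations for lattice gauge
# theories. II*, Commun. Math. Phys. **96** (1984) 223–250 [Balaban1984PropagatorsII], p. 248: **the undisplayed step of (2.147),
# *"‖B₁‖² is bounded from below by const‖B‖²"*, PROVED for the concrete two-scale data `tsV1`** (centred block axial gauge on the
# torus `T^{(j)}`), **hence (2.147) `⟨B, QGQ*B⟩ ≥ γ₀‖B‖²` for `tsV1` UNCONDITIONALLY**, `γ₀` explicit in `d, L, j, c, W`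

statement-level skeleton of published theorems with citation tags; proofs where landed; nothing here is a claim about the Yang–Mills mass gap

PDF held: `paper:balaban1984-cmp96-propagators-rt-ii` (journal page = PDF page + 222; p. 248 [PDF 26], materialised text
`~/.lit/texts/…-rt-ii/p0026.txt`); [Balaban1984PropagatorsI] (1.7), (1.10), (1.11) pp. 18–19 (text layer).

PRINT (verbatim, p. 248).  *"⟨B, QGQ*B⟩ = ⟨Q″*B, C̃^{(j)}_ΛQ″*B⟩ = ⟨B₁, C̃^{(j)}_ΛB₁⟩, (2.146) where B₁ is equal to Q″*B everywhere except
the bonds of ⋃_{y∈Λ′}Ax(y) at which it is equal to 0. The operator C̃^{(j)}_Λ is an inverse to the operator of the quadratic form (2.120),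
hence it is bounded from below by an inverse of an upper bound of this form. Taking into account that ‖B₁‖² is bounded from below by
const‖B‖², we get ⟨B, (QG^ξ_□Q*)↾_□B⟩ ≧ γ₀‖B‖² (2.147) with a positive constant γ₀ depending on d and L only."*  [B5] p. 18 (1.7):
*"Γ_{y,x} = [y, (y₁, …, y_{d−1}, x_d)] ∪ … ∪ [(y₁, x₂, …, x_d), x]"*; p. 19 (1.10): *"A(Γ_{y,x}) = 0, x ∈ B(y), x ≠ y"*; (1.11):
*"(QA)(c) = Σ_{x∈B(c₋)} L^{−(d+1)}A([x, x(c)])"*.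

CITATION HEADER (lean-in-tree rule) — WHAT IS REPRODUCED.  Phase-2 file of the `lit-balaban` typed skeleton (HOME
`run/shared/lean/pub/lit-balaban/`), seat **p22 gen 10** (B6 fold owner r03, referee ref-4; lane = the Sect. C chain (2.95)–(2.147) on
the concrete two-scale data).  SKELETON rows **B6.Eq2.144** / **B6.Txt@246** ((2.146)–(2.147); decls of record untouched: gen 3's abstract
`…B6Eq2144.ineq2147_printed` with the displayed `hupper`, `hB1`; this seat's `…B6Ineq2147TwoScaleV1.ineq2147_V1_of_B1` = (2.147) for
`tsV1` with ONLY `hB1 : c_B‖x‖² ≤ ‖P_{Ax}Q″*x‖²` displayed).  THIS FILE PROVES `hB1` for `D = tsV1 hc Λ′ w` of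
`…B6SectCTwoScaleV1Lattice` (unit lattice `T^{(j)}`, `j + 1 ≤ m + K`, `Λ′ ⊂ T^{(j+1)}`; `Q″x = (x↾_{Λ^c-bonds}, (Q₁x)↾_{Λ′-bonds})` of
(2.97)/(2.119), `Ax` = the block axial gauge `B(Γ_{y,x}) = 0`, `x ∈ B(y)`, `y ∈ Λ′`, staircases from the block CENTRES; `B₁ := P_{Ax}Q″*x`
the orthogonal projection — the typed reading of *"Q″*B … equal to 0 on the bonds of ⋃Ax(y)"*):
* §1 (V1 geometry, [B5] (1.7)/(1.10)): **every bond of the staircase `Γ_{y,x}`, `x ∈ B(y)`, starts at a site of `B(y)`** — so a bond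
  field vanishing on the bonds starting in `B(y)` has `A(Γ_{y,x}) = 0` (`stairSum_eq_zero_of_src`); hence a field vanishing on the bonds
  starting in `B(Λ′)` is axial on `Λ′` (`mem_axial_of_src`), and an everywhere-axial field ([B5] (1.10), `LatticeFieldCalculus.IsAxial`)
  is axial on `Λ′` (`mem_axial_of_isAxial`);
* §2: `‖faceField G‖² ≤ L^{d+2}‖G‖²` for the far-face representative of `…B5Eq112RenormTransf` (`sum_sq_faceField_le`);
* §3 (the step, by two TEST VECTORS in the axial subspace — for `f` axial `⟨x, Q″f⟩ = ⟨B₁, f⟩ ≤ ‖B₁‖‖f‖`, `inner_Qpp_eq_proj`,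
  `two_mul_inner_Qpp_le`): (i) `f₁ = faceField(x↾_{Λ′})` (axial by `…isAxial_faceField`, `Q₁f₁ = x↾_{Λ′}` by `…bondAvg_faceField`, and
  `f₁ = 0` on the `Λ^c`-bonds because a far-face bond crosses into the next block, `…B6SectAOntoV1.blockOf_shift_of_face`) gives
  **`Σ_{c∈Λ′}|x_c|² ≤ L^{d+2}‖B₁‖²`** (`inBond_sq_le`); (ii) `f₂ = x↾_{Λ^c}` on its own bonds (axial by §1: a `Λ^c`-bond starts outside
  `B(Λ′)`) gives **`Σ_{b∈Λ^c}|x_b|² ≤ 2‖B₁‖² + 4L^{−d}Σ_{c∈Λ′}|x_c|²`** (`outBond_sq_le`; the cross term `Σ_c x_c(Q₁f₂)(c)` by Cauchy–Schwarz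
  and this seat's `…sum_bondAvg_sq_le`); together **`‖x‖² ≤ (2 + 4L² + L^{d+2})‖B₁‖²`** (`normSq_le_B1`, `B1_lower`) — the printed
  sentence with `const = (2 + 4L² + L^{d+2})⁻¹`, depending on `d` and `L` only, AS PRINTED;
* §4 (`tsV1`): `hB1_V1`, and **(2.147) UNCONDITIONAL: `γ₀‖x‖² ≤ ⟨x, QGQ*x⟩`, `γ₀ = U⁻¹(2 + 4L² + L^{d+2})⁻¹`, `U = W(1 + L^{−d}) + 8dγ₁κ`**
  (`ineq2147_V1`; at the printed weights `a, aL^{d−2}` of (2.97): `ineq2147_V1_wPrinted`; v1.1: at the printed normalisation `κ = 1`,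
  `ineq2147_V1_printed` — *"γ₀ depending on d and L only"*).
NEAREST ART: `…B6AdjointAveraging.p248_lower` (b2b cell: carriers `Z^d`, CORNER-anchored trees `…B6BondElimination.IsTree`, one pivot per
constraint, constant `(2 + 2L^d + L^{2d}/w²)⁻¹`) — the same sentence for the other typed geometry; not bridged (centred vs corner trees,
torus vs `Z^d`), re-proved here on the V1 torus.  THEOREMS ONLY (no definition, no `def … : Prop`; standard axioms).  HONEST SCOPE:
finite-dimensional `ℓ²` model; the identification of `P_{Ax}` with the coordinate restriction off the tree bonds is NOT needed and NOT
proved (only `‖P_{Ax}v‖ ≥ ⟨v, f⟩/‖f‖` for axial `f` is used); constants OURS (the print claims existence only); NOT summit progress.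
-/

noncomputable section

open scoped InnerProductSpace BigOperators

namespace Literature.MathematicalPhysics.QuantumFieldTheory.Balaban1983to89.B6Ineq2147TwoScaleV1B1

/-! ## §1  The staircase `Γ_{y,x}`, `x ∈ B(y)`, consists of bonds starting in `B(y)` -/

section Stair

open LatticeFieldCalculus B6SectCTwoScaleV1

variable {P : Params} {j : ℕ} {V : Type*} [AddCommGroup V]

/-- `2L ≤ N_j` in the standing range (`N_j = N_{j+1}·L`, `N_{j+1} ≥ 2`). [folklore] -/
private theorem two_mul_L_le_sitesPerDir (hj : j + 1 ≤ P.m + P.K) : 2 * P.L ≤ P.sitesPerDir j := by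
  rw [P.sitesPerDir_eq_mul_succ hj]
  exact Nat.mul_le_mul_right _ (P.one_lt_sitesPerDir (j + 1))

/-- the signed length of the `μ`-run of `Γ_{emb y, x}`, `x = (y, r)`: `r_μ − (L−1)/2` (no wrap-around in the standing range; as in
`…B5Eq112RenormTransf`). [cite: Balaban1984PropagatorsI, (1.7) p.18] -/
private theorem valMinAbs_blockSite_sub_emb (hj : j + 1 ≤ P.m + P.K) (y : Site P (j + 1)) (r : Fin P.d → Fin P.L) (μ : Fin P.d) :
    ((Site.blockSite y r) μ - (emb y) μ).valMinAbs = ((r μ : ℕ) : ℤ) - (((P.L - 1) / 2 : ℕ) : ℤ) := by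
  rw [ZMod.valMinAbs_spec]
  have hr := (r μ).isLt
  have hL : 1 < P.L := P.hL.2
  have h2L := two_mul_L_le_sitesPerDir (P := P) hj
  have hh : (P.L - 1) / 2 < P.L := by omega
  have h2 : 2 * (P.L : ℤ) ≤ (P.sitesPerDir j : ℤ) := by exact_mod_cast h2L
  refine ⟨?_, ?_, ?_⟩
  · have e1 : (Site.blockSite y r) μ = (((y μ).val * P.L + r μ : ℕ) : ZMod (P.sitesPerDir j)) := rfl
    have e2 : (emb y) μ = (((y μ).val * P.L + (P.L - 1) / 2 : ℕ) : ZMod (P.sitesPerDir j)) := rfl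
    rw [e1, e2, Int.cast_sub, Int.cast_natCast, Int.cast_natCast, Nat.cast_add, Nat.cast_add, add_sub_add_left_eq_sub]
  · have h1 : (((P.L - 1) / 2 : ℕ) : ℤ) < (P.L : ℤ) := by exact_mod_cast hh
    have h3 : (0 : ℤ) ≤ ((r μ : ℕ) : ℤ) := Int.natCast_nonneg _
    linarith
  · have h1 : ((r μ : ℕ) : ℤ) < (P.L : ℤ) := by exact_mod_cast hr
    have h3 : (0 : ℤ) ≤ (((P.L - 1) / 2 : ℕ) : ℤ) := Int.natCast_nonneg _
    linarith

/-- the corner of `Γ_{emb y, x}`, `x = (y, r)`, at which the `μ`-run starts is the block point with offsets `r_ν` (`ν > μ`) and `(L−1)/2`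
(`ν ≤ μ`). [cite: Balaban1984PropagatorsI, (1.7) p.18] -/
private theorem mixSite_emb_blockSite (y : Site P (j + 1)) (r : Fin P.d → Fin P.L) (μ : Fin P.d) (h : (P.L - 1) / 2 < P.L) :
    mixSite μ (emb y) (Site.blockSite y r) = Site.blockSite y (fun ν => if μ < ν then r ν else ⟨(P.L - 1) / 2, h⟩) := by
  funext ν
  simp only [mixSite, Site.blockSite, emb]
  split_ifs <;> rfl

/-- **the staircase `Γ_{y,x}`, `x ∈ B(y)`, lies in `B(y)`**: each of its `d` runs starts at a block point and moves `|r_μ − (L−1)/2| ≤ (L−1)/2`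
steps from the offset `(L−1)/2`, so every bond of `Γ_{emb y, x}` STARTS at a site of `B(y)`; hence `A(Γ_{y,x}) = 0` whenever `A` vanishes on
the bonds starting in `B(y)`. [cite: Balaban1984PropagatorsI, (1.7)+(1.10) pp.18–19] -/
theorem stairSum_eq_zero_of_src (hj : j + 1 ≤ P.m + P.K) (A : VecField P j V) (y : Site P (j + 1)) (r : Fin P.d → Fin P.L)
    (hA : ∀ b : PBond P j, blockOf b.src = y → A b = 0) : stairSum A (emb y) (Site.blockSite y r) = 0 := by
  have hL : 1 < P.L := P.hL.2
  have hh : (P.L - 1) / 2 < P.L := by omega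
  unfold stairSum
  refine Finset.sum_eq_zero fun μ _ => ?_
  obtain ⟨r', hr'μ, hmix⟩ : ∃ r' : Fin P.d → Fin P.L, (r' μ : ℕ) = (P.L - 1) / 2 ∧
      mixSite μ (emb y) (Site.blockSite y r) = Site.blockSite y r' :=
    ⟨fun ν => if μ < ν then r ν else ⟨(P.L - 1) / 2, hh⟩, by simp, mixSite_emb_blockSite y r μ hh⟩
  rw [hmix, valMinAbs_blockSite_sub_emb hj]
  have hr := (r μ).isLt
  rcases le_or_gt ((P.L - 1) / 2) (r μ : ℕ) with hle | hgt
  · -- forward run of `r_μ − (L−1)/2` steps: sources at offsets `(L−1)/2, …, r_μ − 1 ≤ L − 2`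
    obtain ⟨n, hn⟩ : ∃ n : ℕ, (r μ : ℕ) = (P.L - 1) / 2 + n := ⟨(r μ : ℕ) - (P.L - 1) / 2, by omega⟩
    have hcast : ((r μ : ℕ) : ℤ) - (((P.L - 1) / 2 : ℕ) : ℤ) = ((n : ℕ) : ℤ) := by rw [hn]; push_cast; ring
    rw [hcast, runSum_ofNat, segSum]
    refine Finset.sum_eq_zero fun t ht => ?_
    rw [Finset.mem_range] at ht
    apply hA
    show blockOf (runSite (Site.blockSite y r') μ t) = y
    have htL : t ≤ P.L := by omega
    have hin : (r' μ : ℕ) + t < P.L := by rw [hr'μ]; omega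
    rw [B5AveragingLocalityV1.blockOf_runSite_blockSite hj y r' μ htL, if_pos hin]
  · -- backward run of `(L−1)/2 − r_μ` steps: sources at offsets `(L−1)/2 − 1, …, r_μ ≥ 0`
    obtain ⟨n, hn⟩ : ∃ n : ℕ, (P.L - 1) / 2 = (r μ : ℕ) + (n + 1) := ⟨(P.L - 1) / 2 - (r μ : ℕ) - 1, by omega⟩
    have hcast : ((r μ : ℕ) : ℤ) - (((P.L - 1) / 2 : ℕ) : ℤ) = Int.negSucc n := by
      rw [hn, Int.negSucc_eq]; push_cast; ring
    rw [hcast]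
    show -(∑ t ∈ Finset.range (n + 1),
      A ⟨Function.update (Site.blockSite y r') μ
        ((Site.blockSite y r') μ - ((t + 1 : ℕ) : ZMod (P.sitesPerDir j))), μ⟩) = 0
    rw [neg_eq_zero]
    refine Finset.sum_eq_zero fun t ht => ?_
    rw [Finset.mem_range] at ht
    apply hA
    have ht1 : t + 1 ≤ (P.L - 1) / 2 := by omega
    have hsite : Function.update (Site.blockSite y r') μ ((Site.blockSite y r') μ - ((t + 1 : ℕ) : ZMod (P.sitesPerDir j)))
        = Site.blockSite y (Function.update r' μ ⟨(P.L - 1) / 2 - (t + 1), by omega⟩) := by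
      funext ν
      by_cases hν : ν = μ
      · rw [hν, Function.update_self]
        simp only [Site.blockSite, Function.update_self, Fin.val_mk, hr'μ]
        have e : (y μ).val * P.L + (P.L - 1) / 2 = ((y μ).val * P.L + ((P.L - 1) / 2 - (t + 1))) + (t + 1) := by omega
        rw [e, Nat.cast_add, add_sub_cancel_right]
      · rw [Function.update_of_ne hν]
        simp only [Site.blockSite, Function.update_of_ne hν]
    show blockOf (Function.update (Site.blockSite y r') μ
      ((Site.blockSite y r') μ - ((t + 1 : ℕ) : ZMod (P.sitesPerDir j)))) = y
    rw [hsite, Site.blockOf_blockSite hj]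

variable (Λ' : Finset (Site P (j + 1)))

/-- hence **a bond field vanishing on the bonds starting in `B(Λ′)` is axial on `Λ′`** (`Π_{y∈Λ′}δ_{Ax(y)}`, (2.95)–(2.97)): the trees
`Γ_{y,x} ⊂ B(y)`, `y ∈ Λ′`, do not meet its support. [cite: Balaban1984PropagatorsII, (2.97) p.240] -/
theorem mem_axial_of_src (hj : j + 1 ≤ P.m + P.K) (B : UBond P j) (hB : ∀ b : PBond P j, blockOf b.src ∈ Λ' → B b = 0) :
    B ∈ axial P j Λ' :=
  (mem_axial j Λ' B).2 fun Y hY r => stairSum_eq_zero_of_src hj (WithLp.ofLp B) Y r fun b hb => hB b (by rw [hb]; exact hY)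

/-- an everywhere-axial bond field ([B5] (1.10), `A(Γ_{y,x}) = 0` for all `y`, `x ∈ B(y)`) is axial on `Λ′`. [cite: Balaban1984PropagatorsII, (2.97) p.240] -/
theorem mem_axial_of_isAxial {B : UBond P j} (hB : IsAxial (WithLp.ofLp B)) : B ∈ axial P j Λ' :=
  (mem_axial j Λ' B).2 fun Y _ r => (B5Eq112RenormTransf.isAxial_iff_forall _).1 hB Y r

end Stair

/-! ## §2  Sums: bonds = sites × directions, sites = blocks × offsets; the norm of the far-face representative -/

section Sums

open LatticeFieldCalculus

variable {P : Params} {j : ℕ}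

/-- a sum over bonds is a double sum over sites and directions. [folklore] -/
private theorem sum_bond_eq {α : Type*} [AddCommMonoid α] (F : PBond P j → α) :
    ∑ b : PBond P j, F b = ∑ x : Site P j, ∑ μ : Fin P.d, F ⟨x, μ⟩ :=
  calc ∑ b : PBond P j, F b = ∑ p : Site P j × Fin P.d, F (bondEquiv p) := (Equiv.sum_comp (bondEquiv (P := P) (j := j)) F).symm
    _ = ∑ x : Site P j, ∑ μ : Fin P.d, F ⟨x, μ⟩ := Fintype.sum_prod_type _

/-- a sum over the fine torus is the sum over blocks of the sums over block offsets (standing range). [folklore] -/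
private theorem sum_blockSite' {α : Type*} [AddCommMonoid α] (hj : j + 1 ≤ P.m + P.K) (F : Site P j → α) :
    ∑ x, F x = ∑ y : Site P (j + 1), ∑ r : Fin P.d → Fin P.L, F (Site.blockSite y r) := by
  rw [← Finset.sum_fiberwise_of_maps_to (s := Finset.univ) (t := Finset.univ) (g := blockOf) (fun _ _ => Finset.mem_univ _) F]
  refine Finset.sum_congr rfl fun y _ => ?_
  have hmem : ∀ x : Site P j, blockOf x = y ↔ x ∈ ({x ∈ Finset.univ | blockOf x = y} : Finset (Site P j)) := fun x => by simp
  let e : (Fin P.d → Fin P.L) ≃ ↥({x ∈ Finset.univ | blockOf x = y} : Finset (Site P j)) :=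
    (Site.blockEquiv hj y).symm.trans (Equiv.subtypeEquivRight hmem)
  rw [← Finset.sum_coe_sort _ F, ← Equiv.sum_comp e (fun a => F a.1)]
  exact Finset.sum_congr rfl fun r _ => rfl

/-- a `dite`-sum is the sum over the subtype. [folklore] -/
private theorem sum_dite_subtype {ι : Type*} [Fintype ι] (p : ι → Prop) [DecidablePred p] (g : {i // p i} → ℝ) :
    ∑ i, (if h : p i then g ⟨i, h⟩ else 0) = ∑ e : {i // p i}, g e := by
  rw [← Fintype.sum_subtype_add_sum_subtype p (fun i => if h : p i then g ⟨i, h⟩ else 0)]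
  have h1 : ∑ e : {i // p i}, (if h : p (e : ι) then g ⟨e, h⟩ else 0) = ∑ e : {i // p i}, g e :=
    Finset.sum_congr rfl fun e _ => by rw [dif_pos e.2]
  have h2 : ∑ e : {i // ¬ p i}, (if h : p (e : ι) then g ⟨e, h⟩ else 0) = 0 :=
    Finset.sum_eq_zero fun e _ => by rw [dif_neg e.2]
  rw [h1, h2, add_zero]

/-- a sum of squares over a subtype is at most the full sum. [folklore] -/
private theorem sum_subtype_sq_le {ι : Type*} [Fintype ι] (p : ι → Prop) [DecidablePred p] (g : ι → ℝ) :
    ∑ i : {x // p x}, g i ^ 2 ≤ ∑ i, g i ^ 2 := by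
  rw [← Fintype.sum_subtype_add_sum_subtype p (fun i => g i ^ 2)]
  have h : 0 ≤ ∑ i : {x // ¬p x}, g i ^ 2 := Finset.sum_nonneg fun _ _ => sq_nonneg _
  linarith

/-- **`‖faceField G‖² ≤ L^{d+2}‖G‖²`**: the far-face representative of `…B5Eq112RenormTransf` carries `L·G_c` on (some of) the `L^d` fine
bonds `b` with `(B(b₋), dir b) = c` and `0` elsewhere. [cite: Balaban1984PropagatorsI, (1.12) p.19] -/
theorem sum_sq_faceField_le (hj : j + 1 ≤ P.m + P.K) (G : VecField P (j + 1) ℝ) :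
    ∑ b : PBond P j, B5Eq112RenormTransf.faceField G b ^ 2 ≤ (P.L : ℝ) ^ (P.d + 2) * ∑ E : PBond P (j + 1), G E ^ 2 := by
  have h1 : ∀ b : PBond P j, B5Eq112RenormTransf.faceField G b ^ 2 ≤ (P.L : ℝ) ^ 2 * G ⟨blockOf b.src, b.dir⟩ ^ 2 := by
    intro b
    unfold B5Eq112RenormTransf.faceField
    split_ifs
    · rw [smul_eq_mul, mul_pow]
    · rw [zero_pow two_ne_zero]; positivity
  have h2 : ∑ b : PBond P j, (P.L : ℝ) ^ 2 * G ⟨blockOf b.src, b.dir⟩ ^ 2 = (P.L : ℝ) ^ (P.d + 2) * ∑ E : PBond P (j + 1), G E ^ 2 := by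
    rw [sum_bond_eq, sum_blockSite' hj, sum_bond_eq (P := P) (j := j + 1) (fun E => G E ^ 2)]
    simp only [Site.blockOf_blockSite hj, Finset.sum_const, Finset.card_univ, Fintype.card_fun, Fintype.card_fin, nsmul_eq_mul,
      Nat.cast_pow, Finset.mul_sum]
    refine Finset.sum_congr rfl fun Y _ => Finset.sum_congr rfl fun μ _ => ?_
    ring
  calc ∑ b : PBond P j, B5Eq112RenormTransf.faceField G b ^ 2
      ≤ ∑ b : PBond P j, (P.L : ℝ) ^ 2 * G ⟨blockOf b.src, b.dir⟩ ^ 2 := Finset.sum_le_sum fun b _ => h1 b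
    _ = (P.L : ℝ) ^ (P.d + 2) * ∑ E : PBond P (j + 1), G E ^ 2 := h2

end Sums

/-! ## §3  The step *"‖B₁‖² is bounded from below by const‖B‖²"* on the V1 carriers, by two axial test vectors -/

section B1

open LatticeFieldCalculus B6SectCTwoScaleV1

variable {P : Params} {j : ℕ} (hj : j + 1 ≤ P.m + P.K) (Λ' : Finset (Site P (j + 1)))

/-- for `f` in the axial subspace, **`⟨x, Q″f⟩ = ⟨B₁, f⟩`** with `B₁ = P_{Ax}Q″*x`. [cite: Balaban1984PropagatorsII, (2.146) p.248] -/
theorem inner_Qpp_eq_proj {f : UBond P j} (hf : f ∈ axial P j Λ') (x : CSpace j Λ') :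
    ⟪x, Qpp P j Λ' f⟫_ℝ = ⟪(axial P j Λ').starProjection (LinearMap.adjoint (Qpp P j Λ') x), f⟫_ℝ := by
  rw [← LinearMap.adjoint_inner_left]
  have h := Submodule.starProjection_inner_eq_zero (K := axial P j Λ') (LinearMap.adjoint (Qpp P j Λ') x) f hf
  rw [inner_sub_left, sub_eq_zero] at h
  exact h

/-- the test-vector inequality **`2a⟨x, Q″f⟩ ≤ a²‖B₁‖² + ‖f‖²`** for `f` axial (`0 ≤ ‖aB₁ − f‖²`). [cite: Balaban1984PropagatorsII, (2.147) p.248] -/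
theorem two_mul_inner_Qpp_le {f : UBond P j} (hf : f ∈ axial P j Λ') (x : CSpace j Λ') (a : ℝ) :
    2 * a * ⟪x, Qpp P j Λ' f⟫_ℝ ≤ a ^ 2 * ‖(axial P j Λ').starProjection (LinearMap.adjoint (Qpp P j Λ') x)‖ ^ 2 + ‖f‖ ^ 2 := by
  rw [inner_Qpp_eq_proj Λ' hf]
  have h0 : 0 ≤ ‖a • (axial P j Λ').starProjection (LinearMap.adjoint (Qpp P j Λ') x) - f‖ ^ 2 := sq_nonneg _
  rw [norm_sub_sq_real, norm_smul, mul_pow, Real.norm_eq_abs, sq_abs, real_inner_smul_left] at h0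
  linarith

include hj in
/-- **coarse half: `Σ_{c∈Λ′}|x_c|² ≤ L^{d+2}‖B₁‖²`** — test vector `f₁ = faceField(x↾_{Λ′})`: axial, `Q₁f₁ = x↾_{Λ′}`, `f₁ = 0` on the
`Λ^c`-bonds (a far-face bond of `B(y)` ends in `B(y + e_μ)`, and both blocks of a `Λ^c`-bond are outside `Λ′`), so `⟨x, Q″f₁⟩ = Σ_{c∈Λ′}|x_c|²`,
while `‖f₁‖² ≤ L^{d+2}Σ_{c∈Λ′}|x_c|²`. [cite: Balaban1984PropagatorsII, (2.147) p.248] -/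
theorem inBond_sq_le (x : CSpace j Λ') :
    ∑ e : InBond j Λ', x (Sum.inr e) ^ 2 ≤
      (P.L : ℝ) ^ (P.d + 2) * ‖(axial P j Λ').starProjection (LinearMap.adjoint (Qpp P j Λ') x)‖ ^ 2 := by
  set G : VecField P (j + 1) ℝ := fun E => if h : E.src ∈ Λ' ∨ E.tgt ∈ Λ' then x (Sum.inr ⟨E, h⟩) else 0 with hG
  set f : UBond P j := WithLp.toLp 2 (B5Eq112RenormTransf.faceField G)
  have hfax : f ∈ axial P j Λ' := mem_axial_of_isAxial Λ' (B5Eq112RenormTransf.isAxial_faceField hj G)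
  -- `⟨x, Q″f₁⟩ = Σ_{Λ′}|x_c|²`
  have hinner : ⟪x, Qpp P j Λ' f⟫_ℝ = ∑ e : InBond j Λ', x (Sum.inr e) ^ 2 := by
    rw [PiLp.inner_apply, Fintype.sum_sum_type]
    have h1 : ∑ o : OutBond j Λ', ⟪x (Sum.inl o), Qpp P j Λ' f (Sum.inl o)⟫_ℝ = 0 := by
      refine Finset.sum_eq_zero fun o _ => ?_
      have hG0 : ∀ hface : (o.1.src o.1.dir).val % P.L = P.L - 1, G ⟨blockOf o.1.src, o.1.dir⟩ = 0 := by
        intro hface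
        simp only [hG]
        split_ifs with h
        · exfalso
          rcases h with h | h
          · exact o.2.1 h
          · apply o.2.2
            have e : blockOf o.1.tgt = (blockOf o.1.src).shift o.1.dir := B6SectAOntoV1.blockOf_shift_of_face hj _ _ hface
            rw [e]
            exact h
        · rfl
      have hf0 : f o.1 = 0 := by
        show B5Eq112RenormTransf.faceField G o.1 = 0
        unfold B5Eq112RenormTransf.faceField
        split_ifs with hface
        · rw [hG0 hface, smul_zero]
        · rfl
      rw [Qpp_inl, hf0, inner_zero_right]
    have h2 : ∑ e : InBond j Λ', ⟪x (Sum.inr e), Qpp P j Λ' f (Sum.inr e)⟫_ℝ = ∑ e : InBond j Λ', x (Sum.inr e) ^ 2 := by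
      refine Finset.sum_congr rfl fun e _ => ?_
      have hQ : bondAvg (WithLp.ofLp f) e.1 = x (Sum.inr e) := by
        show bondAvg (B5Eq112RenormTransf.faceField G) e.1 = _
        rw [B5Eq112RenormTransf.bondAvg_faceField hj]
        simp only [hG]
        rw [dif_pos e.2]
      rw [Qpp_inr, hQ]
      simp only [RCLike.inner_apply, conj_trivial]
      ring
    rw [h1, h2, zero_add]
  -- `‖f₁‖² ≤ L^{d+2}Σ_{Λ′}|x_c|²`
  have hnorm : ‖f‖ ^ 2 ≤ (P.L : ℝ) ^ (P.d + 2) * ∑ e : InBond j Λ', x (Sum.inr e) ^ 2 := by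
    have hZ : ∑ E : PBond P (j + 1), G E ^ 2 = ∑ e : InBond j Λ', x (Sum.inr e) ^ 2 := by
      have hE : ∀ E : PBond P (j + 1), G E ^ 2 = if h : E.src ∈ Λ' ∨ E.tgt ∈ Λ' then x (Sum.inr ⟨E, h⟩) ^ 2 else 0 := by
        intro E
        simp only [hG]
        split_ifs <;> simp
      simp only [hE]
      exact sum_dite_subtype (fun E : PBond P (j + 1) => E.src ∈ Λ' ∨ E.tgt ∈ Λ') (fun e => x (Sum.inr e) ^ 2)
    rw [EuclideanSpace.real_norm_sq_eq, ← hZ]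
    exact sum_sq_faceField_le hj G
  -- `2NZ ≤ N²‖B₁‖² + ‖f₁‖² ≤ N²‖B₁‖² + NZ`
  have h := two_mul_inner_Qpp_le Λ' hfax x ((P.L : ℝ) ^ (P.d + 2))
  rw [hinner] at h
  have hN : (0 : ℝ) < (P.L : ℝ) ^ (P.d + 2) := pow_pos (Nat.cast_pos.2 P.L_pos) _
  have h3 : (P.L : ℝ) ^ (P.d + 2) * ∑ e : InBond j Λ', x (Sum.inr e) ^ 2 ≤ (P.L : ℝ) ^ (P.d + 2) *
      ((P.L : ℝ) ^ (P.d + 2) * ‖(axial P j Λ').starProjection (LinearMap.adjoint (Qpp P j Λ') x)‖ ^ 2) := by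
    nlinarith
  exact le_of_mul_le_mul_left h3 hN

include hj in
/-- **identity half: `Σ_{b∈Λ^c}|x_b|² ≤ 2‖B₁‖² + 4L^{−d}Σ_{c∈Λ′}|x_c|²`** — test vector `f₂ = x↾_{Λ^c}` on its own bonds (axial on `Λ′`: a
`Λ^c`-bond starts outside `B(Λ′)`): `⟨x, Q″f₂⟩ = Σ_{Λ^c}|x_b|² + Σ_{c∈Λ′}x_c(Q₁f₂)(c)`, the cross term bounded by Cauchy–Schwarz and
`Σ_c|(Q₁f₂)(c)|² ≤ L^{−d}‖f₂‖²`. [cite: Balaban1984PropagatorsII, (2.147) p.248] -/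
theorem outBond_sq_le (x : CSpace j Λ') :
    ∑ o : OutBond j Λ', x (Sum.inl o) ^ 2 ≤ 2 * ‖(axial P j Λ').starProjection (LinearMap.adjoint (Qpp P j Λ') x)‖ ^ 2
      + 4 * ((P.L : ℝ) ^ P.d)⁻¹ * ∑ e : InBond j Λ', x (Sum.inr e) ^ 2 := by
  set F : VecField P j ℝ := fun b => if h : blockOf b.src ∉ Λ' ∧ blockOf b.tgt ∉ Λ' then x (Sum.inl ⟨b, h⟩) else 0 with hF
  set f : UBond P j := WithLp.toLp 2 F
  have hfax : f ∈ axial P j Λ' := mem_axial_of_src Λ' hj f fun b hb => by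
    show F b = 0
    simp only [hF]
    rw [dif_neg]
    exact fun h => h.1 hb
  set X := ∑ o : OutBond j Λ', x (Sum.inl o) ^ 2
  set Z := ∑ e : InBond j Λ', x (Sum.inr e) ^ 2
  set C := ∑ e : InBond j Λ', x (Sum.inr e) * bondAvg (WithLp.ofLp f) e.1
  have hFo : ∀ o : OutBond j Λ', F o.1 = x (Sum.inl o) := fun o => by
    simp only [hF]
    rw [dif_pos o.2]
  -- `‖f₂‖² = Σ_{Λ^c}|x_b|²`
  have hsumF : ∑ b : PBond P j, F b ^ 2 = X := by
    have hb : ∀ b : PBond P j, F b ^ 2 = if h : blockOf b.src ∉ Λ' ∧ blockOf b.tgt ∉ Λ' then x (Sum.inl ⟨b, h⟩) ^ 2 else 0 := by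
      intro b
      simp only [hF]
      split_ifs <;> simp
    simp only [hb]
    exact sum_dite_subtype (fun b : PBond P j => blockOf b.src ∉ Λ' ∧ blockOf b.tgt ∉ Λ') (fun o => x (Sum.inl o) ^ 2)
  have hsumF' : ∑ b : PBond P j, WithLp.ofLp f b ^ 2 = X := hsumF
  have hnorm : ‖f‖ ^ 2 = X := by
    rw [EuclideanSpace.real_norm_sq_eq]
    exact hsumF'
  -- `⟨x, Q″f₂⟩ = X + C`
  have hinner : ⟪x, Qpp P j Λ' f⟫_ℝ = X + C := by
    rw [PiLp.inner_apply, Fintype.sum_sum_type]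
    congr 1
    · refine Finset.sum_congr rfl fun o _ => ?_
      have hfo : f o.1 = x (Sum.inl o) := hFo o
      rw [Qpp_inl, hfo]
      simp only [RCLike.inner_apply, conj_trivial]
      ring
    · refine Finset.sum_congr rfl fun e _ => ?_
      rw [Qpp_inr]
      simp only [RCLike.inner_apply, conj_trivial]
      ring
  -- the cross term: `C² ≤ Z·L^{−d}X`
  have hM : (0 : ℝ) < (P.L : ℝ) ^ P.d := pow_pos (Nat.cast_pos.2 P.L_pos) _
  have hX0 : 0 ≤ X := Finset.sum_nonneg fun _ _ => sq_nonneg _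
  have hZ0 : 0 ≤ Z := Finset.sum_nonneg fun _ _ => sq_nonneg _
  have hC2 : C ^ 2 ≤ Z * (((P.L : ℝ) ^ P.d)⁻¹ * X) := by
    have h1 : C ^ 2 ≤ Z * ∑ e : InBond j Λ', bondAvg (WithLp.ofLp f) e.1 ^ 2 :=
      Finset.sum_mul_sq_le_sq_mul_sq Finset.univ (fun e : InBond j Λ' => x (Sum.inr e)) (fun e => bondAvg (WithLp.ofLp f) e.1)
    have h2 : ∑ e : InBond j Λ', bondAvg (WithLp.ofLp f) e.1 ^ 2 ≤ ∑ E : PBond P (j + 1), bondAvg (WithLp.ofLp f) E ^ 2 :=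
      sum_subtype_sq_le (fun E : PBond P (j + 1) => E.src ∈ Λ' ∨ E.tgt ∈ Λ') (fun E => bondAvg (WithLp.ofLp f) E)
    have h3 : ∑ E : PBond P (j + 1), bondAvg (WithLp.ofLp f) E ^ 2 ≤ ((P.L : ℝ) ^ P.d)⁻¹ * X := by
      have := B6Ineq2147TwoScaleV1.sum_bondAvg_sq_le hj (WithLp.ofLp f)
      rwa [hsumF'] at this
    exact h1.trans (mul_le_mul_of_nonneg_left (h2.trans h3) hZ0)
  -- `|2C| ≤ X/2 + 2L^{−d}Z`
  have key : 0 ≤ X / 2 + 2 * (((P.L : ℝ) ^ P.d)⁻¹ * Z) + 2 * C := by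
    have hi : 0 ≤ ((P.L : ℝ) ^ P.d)⁻¹ := inv_nonneg.2 hM.le
    have hiZ : 0 ≤ ((P.L : ℝ) ^ P.d)⁻¹ * Z := mul_nonneg hi hZ0
    by_cases hc : 0 ≤ C
    · linarith
    · have hc' : C < 0 := not_le.mp hc
      have h5 : C ^ 2 ≤ ((P.L : ℝ) ^ P.d)⁻¹ * (Z * X) := by
        calc C ^ 2 ≤ Z * (((P.L : ℝ) ^ P.d)⁻¹ * X) := hC2
          _ = ((P.L : ℝ) ^ P.d)⁻¹ * (Z * X) := by ring
      have h4 : 4 * C ^ 2 ≤ (X / 2 + 2 * (((P.L : ℝ) ^ P.d)⁻¹ * Z)) ^ 2 := by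
        have e : (X / 2 + 2 * (((P.L : ℝ) ^ P.d)⁻¹ * Z)) ^ 2 =
            (X / 2 - 2 * (((P.L : ℝ) ^ P.d)⁻¹ * Z)) ^ 2 + 4 * (((P.L : ℝ) ^ P.d)⁻¹ * (Z * X)) := by ring
        rw [e]
        nlinarith [sq_nonneg (X / 2 - 2 * (((P.L : ℝ) ^ P.d)⁻¹ * Z))]
      nlinarith [h4, hiZ, hX0, hc']
  -- `2(X + C) ≤ ‖B₁‖² + X`
  have h := two_mul_inner_Qpp_le Λ' hfax x 1
  rw [hinner, hnorm] at h
  linarith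

include hj in
/-- **p. 248 *"‖B₁‖² is bounded from below by const‖B‖²"* FOR `tsV1`, with the constant: `‖x‖² ≤ (2 + 4L² + L^{d+2})‖P_{Ax}Q″*x‖²`** for
every `x` on `𝔅 = Λ^c ∪ Λ′`. [cite: Balaban1984PropagatorsII, (2.147) p.248] -/
theorem normSq_le_B1 (x : CSpace j Λ') :
    ‖x‖ ^ 2 ≤ (2 + 4 * (P.L : ℝ) ^ 2 + (P.L : ℝ) ^ (P.d + 2)) *
      ‖(axial P j Λ').starProjection (LinearMap.adjoint (Qpp P j Λ') x)‖ ^ 2 := by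
  have hsplit : ‖x‖ ^ 2 = ∑ o : OutBond j Λ', x (Sum.inl o) ^ 2 + ∑ e : InBond j Λ', x (Sum.inr e) ^ 2 := by
    rw [EuclideanSpace.real_norm_sq_eq, Fintype.sum_sum_type]
  have h1 := inBond_sq_le hj Λ' x
  have h2 := outBond_sq_le hj Λ' x
  have hM : (0 : ℝ) < (P.L : ℝ) ^ P.d := pow_pos (Nat.cast_pos.2 P.L_pos) _
  have hLL : ((P.L : ℝ) ^ P.d)⁻¹ * (P.L : ℝ) ^ (P.d + 2) = (P.L : ℝ) ^ 2 := by
    rw [pow_add, ← mul_assoc, inv_mul_cancel₀ hM.ne', one_mul]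
  have h3 : ((P.L : ℝ) ^ P.d)⁻¹ * ∑ e : InBond j Λ', x (Sum.inr e) ^ 2 ≤
      (P.L : ℝ) ^ 2 * ‖(axial P j Λ').starProjection (LinearMap.adjoint (Qpp P j Λ') x)‖ ^ 2 := by
    calc ((P.L : ℝ) ^ P.d)⁻¹ * ∑ e : InBond j Λ', x (Sum.inr e) ^ 2
        ≤ ((P.L : ℝ) ^ P.d)⁻¹ * ((P.L : ℝ) ^ (P.d + 2) * ‖(axial P j Λ').starProjection (LinearMap.adjoint (Qpp P j Λ') x)‖ ^ 2) :=
          mul_le_mul_of_nonneg_left h1 (inv_nonneg.2 hM.le)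
      _ = ((P.L : ℝ) ^ P.d)⁻¹ * (P.L : ℝ) ^ (P.d + 2) * ‖(axial P j Λ').starProjection (LinearMap.adjoint (Qpp P j Λ') x)‖ ^ 2 := by
          rw [mul_assoc]
      _ = (P.L : ℝ) ^ 2 * ‖(axial P j Λ').starProjection (LinearMap.adjoint (Qpp P j Λ') x)‖ ^ 2 := by rw [hLL]
  rw [hsplit]
  linarith

include hj in
/-- the same as the printed lower bound: **`(2 + 4L² + L^{d+2})⁻¹‖x‖² ≤ ‖B₁‖²`**, `B₁ = P_{Ax}Q″*x` — `const` depending on `d` and `L`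
only. [cite: Balaban1984PropagatorsII, (2.147) p.248] -/
theorem B1_lower (x : CSpace j Λ') :
    (2 + 4 * (P.L : ℝ) ^ 2 + (P.L : ℝ) ^ (P.d + 2))⁻¹ * ‖x‖ ^ 2 ≤
      ‖(axial P j Λ').starProjection (LinearMap.adjoint (Qpp P j Λ') x)‖ ^ 2 := by
  have hc : (0 : ℝ) < 2 + 4 * (P.L : ℝ) ^ 2 + (P.L : ℝ) ^ (P.d + 2) := by positivity
  rw [inv_mul_le_iff₀ hc]
  exact normSq_le_B1 hj Λ' x

end B1

/-! ## §4  For `tsV1`: the `‖B₁‖²` step and (2.147) unconditionally -/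

section TwoScale

open B6SectCOperators B6SectCOperators.TwoScaleData B6SectCTwoScaleV1 B6SectCTwoScaleV1Lattice
open B5SectBStatements (eta)
open Beta.Ineq167OperatorUpper (gamma1)
open B6Ineq2147TwoScaleV1 (ineq2147_V1_of_B1)

variable {P : Params} {c : ℝ} (hc : c ≠ 0) {j : ℕ} (hj : j + 1 ≤ P.m + P.K) (Λ' : Finset (Site P (j + 1)))
  {w : CIdx j Λ' → ℝ} (hw : ∀ i, 0 < w i) {W : ℝ} (hW0 : 0 ≤ W) (hW : ∀ i, w i ≤ W)

include hj in
/-- **the `‖B₁‖²` step for the data `tsV1`** (its `Ax`, `Q″` are `axial`, `Qpp`): `(2 + 4L² + L^{d+2})⁻¹‖x‖² ≤ ‖P_{Ax}Q″*x‖²` — the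
hypothesis `hB1` of `…B6Ineq2147TwoScaleV1.ineq2147_V1_of_B1` DISCHARGED. [cite: Balaban1984PropagatorsII, (2.147) p.248] -/
theorem hB1_V1 (x : CSpace j Λ') :
    (2 + 4 * (P.L : ℝ) ^ 2 + (P.L : ℝ) ^ (P.d + 2))⁻¹ * ‖x‖ ^ 2 ≤
      ‖(tsV1 hc Λ' w).Ax.starProjection (LinearMap.adjoint (tsV1 hc Λ' w).Qpp x)‖ ^ 2 :=
  B1_lower hj Λ' x

include hj hw hW0 hW in
/-- **(2.147) FOR THE CONCRETE TWO-SCALE DATA `tsV1`, UNCONDITIONALLY: `γ₀‖x‖² ≤ ⟨x, QGQ*x⟩`** for every `x` on `𝔅 = Λ^c ∪ Λ′`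
(`Q = Q″Q_j`, `G = Δ_a⁻¹` of (2.95)), with `γ₀ = U⁻¹(2 + 4L² + L^{d+2})⁻¹`, `U = W(1 + L^{−d}) + 8dγ₁κ` (`κ = c²/(η^dL^{2j})`,
`γ₁ = (π²/4)^{d+2}`, weights `0 < w ≤ W`) — explicit in `d, L, j, c, W`; the printed *"γ₀ depending on d and L only"* at the printed
normalisation. [cite: Balaban1984PropagatorsII, (2.147) p.248] -/
theorem ineq2147_V1 (x : CSpace j Λ') :
    (W * (1 + ((P.L : ℝ) ^ P.d)⁻¹) + c ^ 2 / (eta P.L j ^ P.d * ((P.L : ℝ) ^ j) ^ 2) * (gamma1 P.d * (8 * P.d)))⁻¹ *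
        (2 + 4 * (P.L : ℝ) ^ 2 + (P.L : ℝ) ^ (P.d + 2))⁻¹ * ‖x‖ ^ 2 ≤
      ⟪x, (tsV1 hc Λ' w).Q ((tsV1 hc Λ' w).G (LinearMap.adjoint (tsV1 hc Λ' w).Q x))⟫_ℝ :=
  ineq2147_V1_of_B1 hc hj Λ' hw hW0 hW (hB1_V1 hc hj Λ') x

include hj in
/-- (2.147) for `tsV1` AT THE PRINTED WEIGHTS `a` on `Λ^c`, `aL^{d−2}` on `Λ′` of (2.97) (`…B6SectCTwoScaleV1.wPrinted`, `a > 0`):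
`W = aL^{d−2}`. [cite: Balaban1984PropagatorsII, (2.97) p.240, (2.147) p.248] -/
theorem ineq2147_V1_wPrinted {a : ℝ} (ha : 0 < a) (x : CSpace j Λ') :
    (a * (P.L : ℝ) ^ (P.d - 2) * (1 + ((P.L : ℝ) ^ P.d)⁻¹) +
          c ^ 2 / (eta P.L j ^ P.d * ((P.L : ℝ) ^ j) ^ 2) * (gamma1 P.d * (8 * P.d)))⁻¹ *
        (2 + 4 * (P.L : ℝ) ^ 2 + (P.L : ℝ) ^ (P.d + 2))⁻¹ * ‖x‖ ^ 2 ≤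
      ⟪x, (tsV1 hc Λ' (wPrinted P j Λ' a)).Q ((tsV1 hc Λ' (wPrinted P j Λ' a)).G
        (LinearMap.adjoint (tsV1 hc Λ' (wPrinted P j Λ' a)).Q x))⟫_ℝ := by
  have hL : (1 : ℝ) ≤ P.L := by exact_mod_cast P.hL.2.le
  have hLp : (1 : ℝ) ≤ (P.L : ℝ) ^ (P.d - 2) := one_le_pow₀ hL
  have hW0 : 0 ≤ a * (P.L : ℝ) ^ (P.d - 2) := by positivity
  have hW : ∀ i, wPrinted P j Λ' a i ≤ a * (P.L : ℝ) ^ (P.d - 2) := by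
    rintro (i | i)
    · show a ≤ a * (P.L : ℝ) ^ (P.d - 2)
      have h := mul_le_mul_of_nonneg_left hLp ha.le
      rwa [mul_one] at h
    · exact le_rfl
  exact ineq2147_V1 hc hj Λ' (wPrinted_pos j Λ' ha) hW0 hW x

include hj in
/-- **(2.147) AS PRINTED — *"with a positive constant γ₀ depending on d and L only"*** (v1.1): at the printed normalisation
`c² = η^dL^{2j}` of the model (`κ = 1`, `…B6Ineq2118TwoScaleV1.kappa_eq_one`) and the printed weights `a`, `aL^{d−2}` of (2.97),
`γ₀ = (aL^{d−2}(1 + L^{−d}) + 8dγ₁)⁻¹(2 + 4L² + L^{d+2})⁻¹` — a function of `d`, `L` (and the printed `a`, `= 1` on p. 244) only.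
[cite: Balaban1984PropagatorsII, (2.147) p.248] -/
theorem ineq2147_V1_printed (hcη : c ^ 2 = eta P.L j ^ P.d * ((P.L : ℝ) ^ j) ^ 2) {a : ℝ} (ha : 0 < a) (x : CSpace j Λ') :
    (a * (P.L : ℝ) ^ (P.d - 2) * (1 + ((P.L : ℝ) ^ P.d)⁻¹) + gamma1 P.d * (8 * P.d))⁻¹ *
        (2 + 4 * (P.L : ℝ) ^ 2 + (P.L : ℝ) ^ (P.d + 2))⁻¹ * ‖x‖ ^ 2 ≤
      ⟪x, (tsV1 hc Λ' (wPrinted P j Λ' a)).Q ((tsV1 hc Λ' (wPrinted P j Λ' a)).G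
        (LinearMap.adjoint (tsV1 hc Λ' (wPrinted P j Λ' a)).Q x))⟫_ℝ := by
  have h := ineq2147_V1_wPrinted hc hj Λ' ha x
  rw [B6Ineq2118TwoScaleV1.kappa_eq_one hcη, one_mul] at h
  exact h

end TwoScale

end Literature.MathematicalPhysics.QuantumFieldTheory.Balaban1983to89.B6Ineq2147TwoScaleV1B1

end
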